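import Summits.QuantumFields.BalabanUV.T4Continuum.Support.NE7ApeTrivialFlatEndCritical
import Summits.QuantumFields.BalabanUV.T4Continuum.Support.NE7TangentCriticalCover
import Summits.QuantumFields.BalabanUV.T4Continuum.Support.NE7EtaBackgroundFlatStratum
import Summits.QuantumFields.BalabanUV.T4Continuum.Support.NE3EnergyRateFlatClass
import Summits.QuantumFields.BalabanUV.T4Continuum.Support.NE7SmallFieldBootstrap
import Summits.QuantumFields.BalabanUV.T4Continuum.Support.NE7FlatDatumNormalForm
import HarnessLib

/-!
# NE7ApeFlatToronEnd — (APE) ON THE FIBRE OVER EVERY FLAT DATUM WITH HOLONOMY OF FINITE ORDER (torons `1^{w}`, `w` unitary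
# `(N·m)`-periodic), with the SAME constants as the OWNER's END at the trivial flat datum: the cover trick

Cell `pub-balaban`, rung (B)+1 sub-cell t4, lineage `b2b-balaban-t4-ne7-p2`, generation 89 (CRUX PROVER NE7 #2 = co-owner of row NE7, kernel hand); file (D9)
of the gen-89 line, over the OWNER's D8 `NE7ApeTrivialFlatEndCritical.smallField_of_tanCritical_flatTop` (t4-ne7-p1 g74, ROAD v4) and this lineage's (C1)
`NE7TangentCriticalCover.tanCritical_cover`.
WHY.  D8 is the (APE) END on the fibre `cavgIter L (k+1) U = 1` over the TRIVIAL flat datum; its constants `K′, θ` are quantified BEFORE `N` (the number of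
blocks of the torus) — it is `N`-UNIFORM.  The flat stratum of the datum class is larger (tree `NE7EtaBackgroundFlatStratum`, OWNER g58: the flat `N`-periodic
data are the pure gauges `1^{w}` of QUASI-periodic unitary `w`, `w(x + N e_i) = w(x)·h_i` with commuting holonomy constants `h_i` — the torons; memo
`t4/b2b-balaban-t4-ne7-p1-g72/HUNT-H16-GREEN-DISCHARGED.md` §8 (b): «the honest next programme is the twisted-torus dictionary»).  For holonomy of FINITE
ORDER `m` (`w` is `(N·m)`-PERIODIC) no twisted theory is needed: on the `m`-fold cover the datum is a periodic pure gauge, and the END transports.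
THE ARGUMENT (composition BY NAME, every `d ≥ 1`, `L ≥ 2`).  Given `U` unitary `(L^{k+1}N)`-periodic in the multi-level class, `SmallField U (δ∕M²)`,
tangent-critical at period `L^{k+1}N`, with `cavgIter L (k+1) U = 1^{w}`, `w` unitary `(N·m)`-periodic: (1) `U` is `(L^{k+1}·N·m)`-periodic and (C1)
tangent-critical at that period (`NE7TangentCriticalCover.tanCritical_cover`); (2) the BLOW-UP GAUGE `ũ(z) := w(⌊z∕M⌋)⁻¹` (`M = L^{k+1}`; (G2) `NE7FlatDatumNormalForm` §1) is unitary and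
`(M·N·m)`-periodic, and by the gauge covariance of the `(k+1)`-fold average (`NE3CpushGaugeCovariance.cavgIter_gaugeAct`) `cavgIter L (k+1) U^{ũ} = (1^{w})^{w⁻¹} = 1`;
small-field radii, unitarity, periodicity and tangent-criticality pass to `U^{ũ}` (`BlockAverageCurrent.smallField_gaugeAct`, `AveragingDeficitKDatum.isUnitaryCfg_gaugeAct`,
`NE7TanCriticalGauge.tanCritical_gaugeAct`); (3) D8 at `N·m` blocks gives `SmallField U^{ũ} (K′δ²∕M²)` with D8's OWN `K′, θ` (N-uniformity), and the
small-field class is gauge invariant back.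
WHAT ([folklore]; 0 def, 0 sorry).  The blow-up gauge `z ↦ w(⌊z∕L^{k+1}⌋)⁻¹` is (G2) `NE7FlatDatumNormalForm`'s (`blowInv_corner ∕ _unitary ∕ _add_period`;
gauge algebra by the tree's `AveragingDeficitKDatum.gaugeAct_inv_gaugeAct`, `NE3SmoothLiftW.isPeriodicCfg_gaugeAct`); §2 **`smallField_of_tanCritical_flatToron`** —
D8's statement with `cavgIter L (k+1) U = flat` REPLACED by `cavgIter L (k+1) U = gaugeAct w flat`, `w` unitary `(N·m)`-periodic, `m ≥ 1` arbitrary, SAME `∃ K′ θ`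
clause (D8 itself is the case `w = 1`, `m = 1`); §3 **`smallField_of_tanCritical_flatDatum`**
— the INTRINSIC form: the datum `cavgIter L (k+1) U` has all plaquette variables `1` and straight axis holonomies `hol (cavgIter L (k+1) U) 0 (seg i (N·m)) = 1`
(zero curvature ⇒ pure gauge `NE3EnergyRateFlatClass.exists_unitary_gauge_eq_gaugeAct_flatCfg`; the holonomy constants of a periodic pure gauge
`NE7EtaBackgroundFlatStratum.apply_add_period_eq_of_isPeriodicCfg`); §4–§5 THE END ITERATED TO ZERO (the `δ`-uniform bootstrap of §2 iterated by (B)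
`NE7SmallFieldBootstrap.smallField_zero_of_bootstrap`): **`smallField_zero_of_tanCritical_flatToron`** (`∃ θ₀ > 0`: §2's hypotheses with `δ ≤ θ₀` ⟹
`SmallField U 0`) and **`exists_pureGauge_of_tanCritical_flatToron`** (⟹ `∃ g` unitary, `U = 1^{g}`): ON THESE FIBRES THE TANGENT-CRITICAL POINTS OF THE
SMALL-FIELD CLASS ARE EXACTLY THE PURE GAUGES — [B11] Thm 1 (ii)-type uniqueness at flat data, CONCRETE (no abstract carrier; the pure gauges of the fibre are
tangent-critical with action `0` by the OWNER's `NE7EtaBackgroundFlatStratum.hmin_flatStratum`).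
HONEST FRAMING (page 1): a composition of tree theorems BY NAME plus integer-division bookkeeping; the hypotheses left are the END's own (a priori small field at
two radii, the fibre over a flat datum, tangent-criticality) now over EVERY flat datum whose holonomy has finite order — for `U(1)`-valued holonomy constants of
finite order, in particular; NOT reached: holonomy of infinite order modulo the centre (needs the twisted-torus dictionary of H16 §8 (b)), central holonomy
absorption, curved data ([B9] background propagators); (APE) on the data class `𝒟_β` NOT proved; nothing of Bałaban's asserted; NE7 NOT PRINTED ∕ NOT PROVED;
spine PROVED 0∕9; FIXED FINITE T⁴, rung (B)+1 — NOT infinite volume, NOT mass gap, NOT BetaPertH, NOT Clay.  Continuum YM on T⁴ ⇐ BetaPertH ∧ nine spine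
estimates (0/9 proved); BetaPertH ⇐ (D1) ∧ (D4) ∧ CAP+tail; G-an2-4 gates asym, D1 and NE2/3/4.
-/

set_option autoImplicit false

open scoped BigOperators Matrix.Norms.L2Operator
open NormedSpace Finset

namespace Summit.QuantumFields.BalabanUV.T4Continuum.NE7ApeFlatToronEnd

open Literature.MathematicalPhysics.QuantumFieldTheory.Balaban1983to89
open B7Prop1Explicit B7Prop2Explicit
open T4AveragingDeficitWall (IsUnitaryCfg IsSkewDir SmallField hol_flat)
open T4AveragingDeficitWallBoundary (IsPeriodicCfg)
open AveragingDeficitPeriodicCounting (IsPeriodicDir)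
open AveragingDeficitMultiLevelPrep (cavgIter LevelSmall tower cavgIter_unitary_small isPeriodicCfg_cavgIter)
open MinimalActionWitness (flatCfg)
open NE3EnergyRateFlatClass (exists_unitary_gauge_eq_gaugeAct_flatCfg)
open NE7EtaBackgroundFlatStratum (apply_add_period_eq_of_isPeriodicCfg)
open AveragingDeficitKDatum (isUnitaryCfg_gaugeAct gaugeAct_inv_gaugeAct)
open MinimalActionLevels (perWin)
open BlockAveragePushDirSplit (flat)
open BlockAverageCurrent (smallField_gaugeAct)
open NE3HessForm (dAction)
open NE3TangentCovariantTower (dirIter)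
open NE3QbarIterCovLiftPrep (cruxC)
open NE3RightInverseSolveLetters (thetaLoc)
open NE3EnergyShapes (IsUnitarySite)
open NE3CpushGaugeCovariance (cavgIter_gaugeAct)
open NE7TanCriticalGauge (tanCritical_gaugeAct)
open NE7ApeTrivialFlatEndCritical (smallField_of_tanCritical_flatTop)
open NE7TangentCriticalCover (tanCritical_cover isPeriodicCfg_mul)
open NE7SmallFieldBootstrap (smallField_zero_of_bootstrap hol_plaqWord_eq_one_of_smallField_zero)
open NE7FlatDatumNormalForm (blowInv_corner blowInv_unitary blowInv_add_period)
open NE3SmoothLiftW (isPeriodicCfg_gaugeAct tower_eq_pow_mul)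

noncomputable section

variable {d : ℕ} {n : Type*} [Fintype n] [DecidableEq n]

/-! ## §2 THE END ON THE FIBRE OVER A FLAT DATUM WITH FINITE-ORDER HOLONOMY -/

/-- **(APE) ON THE FIBRE OVER EVERY FLAT DATUM WITH HOLONOMY OF FINITE ORDER, FROM TANGENT-CRITICALITY.**  `∃ K′ θ > 0` (on `d`, `card n`, `L`; the SAME
clause as the OWNER's END at the trivial datum): for all `N, m ≥ 1`, `k`, every unitary `(N·m)`-periodic `w` (so `1^{w}` is a flat `N`-periodic datum whose
holonomy constants have order dividing `m`), every unitary `(L^{k+1}N)`-periodic `U` with `SmallField U x` in the multi-level class, `SmallField U (δ∕M²)` with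
`0 ≤ δ ≤ θ`, `δ∕M² ≤ x`, ON THE FIBRE `cavgIter L (k+1) U = 1^{w}` and tangent-critical at period `L^{k+1}N`: `SmallField U (K′δ²∕M²)`. [folklore] -/
theorem smallField_of_tanCritical_flatToron {n : Type} [Fintype n] [DecidableEq n] [Nonempty n] (hd : 1 ≤ d) {L : ℕ} (hL : 2 ≤ L) :
    ∃ K' θ : ℝ, 0 < K' ∧ 0 < θ ∧ ∀ (N : ℕ) [NeZero N] (m : ℕ) [NeZero m] (k : ℕ)
      (w : Site (d + 1) → (Matrix n n ℂ)ˣ) (_hw : IsUnitarySite w)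
      (_hwP : ∀ (y : Site (d + 1)) (i : Fin (d + 1)), w (y + ((N * m : ℕ) : ℤ) • e i) = w y)
      {U : Site (d + 1) → Fin (d + 1) → (Matrix n n ℂ)ˣ} (_hU : IsUnitaryCfg U) {x δ : ℝ} (_hx : 0 ≤ x) (_hs : LevelSmall (d + 1) L k x)
      (_hUx : SmallField U x) (_hδ : 0 ≤ δ) (_hUδ : SmallField U (δ / ((L : ℝ) ^ (k + 1)) ^ 2)) (_hδx : δ / ((L : ℝ) ^ (k + 1)) ^ 2 ≤ x)
      (_hcritU : ∀ φ : Site (d + 1) → Fin (d + 1) → Matrix n n ℂ, IsSkewDir φ → IsPeriodicDir φ ((L ^ (k + 1) * N : ℕ) : ℤ) →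
        dirIter L (k + 1) U φ = 0 → dAction U φ (perWin (d + 1) (L ^ (k + 1) * N)) = 0)
      (_htopU : cavgIter L (k + 1) U = gaugeAct w flat) (_hUP : IsPeriodicCfg U ((L ^ (k + 1) * N : ℕ) : ℤ))
      (_hθ : cruxC (d + 1) L * (((L : ℝ) ^ (k + 1)) ^ 2 * x) < 1) (_hθl : thetaLoc (d + 1) L * (((L : ℝ) ^ (k + 1)) ^ 2 * x) ≤ 1 / 2)
      (_hε : ((L : ℝ) ^ (k + 1)) ^ 2 * x ≤ 1) (_hδθ : δ ≤ θ),
      SmallField U (K' * δ ^ 2 / ((L : ℝ) ^ (k + 1)) ^ 2) := by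
  obtain ⟨K', θ, hK', hθ0, hD8⟩ := smallField_of_tanCritical_flatTop (n := n) hd hL
  refine ⟨K', θ, hK', hθ0, ?_⟩
  intro N _ m _ k w hw hwP U hU x δ hx hs hUx hδ hUδ hδx hcritU htopU hUP hθ hθl hε hδθ
  have hL1 : 1 ≤ L := by omega
  have hN1 : 1 ≤ N := Nat.one_le_iff_ne_zero.mpr (NeZero.ne N)
  have hm1 : 1 ≤ m := Nat.one_le_iff_ne_zero.mpr (NeZero.ne m)
  haveI : NeZero (N * m) := ⟨Nat.mul_ne_zero (NeZero.ne N) (NeZero.ne m)⟩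
  -- the blow-up gauge
  set ut : Site (d + 1) → (Matrix n n ℂ)ˣ := fun z => (w (fun i => z i / (L : ℤ) ^ (k + 1)))⁻¹ with hut
  have hut_u : IsUnitarySite ut := blowInv_unitary k hw
  have hut_P : ∀ (z : Site (d + 1)) (i : Fin (d + 1)), ut (z + (((L ^ (k + 1) * (N * m) : ℕ) : ℤ)) • e i) = ut z :=
    blowInv_add_period hL1 k hwP
  -- (1) the cover: periodicity and tangent-criticality at period `L^{k+1}·(N·m)`
  have hUPm : IsPeriodicCfg U (((L ^ (k + 1) * (N * m) : ℕ) : ℤ)) := by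
    have h := isPeriodicCfg_mul hUP (m : ℤ)
    have hc : (((L ^ (k + 1) * N : ℕ) : ℤ)) * (m : ℤ) = (((L ^ (k + 1) * (N * m) : ℕ) : ℤ)) := by push_cast; ring
    rwa [hc] at h
  have hcritm := tanCritical_cover hL1 k hN1 hm1 hU hx hs hUx hUP hcritU
  -- (2) the gauged configuration
  have hVu : IsUnitaryCfg (gaugeAct ut U) := isUnitaryCfg_gaugeAct hut_u hU
  have hVx : SmallField (gaugeAct ut U) x := smallField_gaugeAct hut_u hUx
  have hVδ : SmallField (gaugeAct ut U) (δ / ((L : ℝ) ^ (k + 1)) ^ 2) := smallField_gaugeAct hut_u hUδ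
  have hVP : IsPeriodicCfg (gaugeAct ut U) (((L ^ (k + 1) * (N * m) : ℕ) : ℤ)) := isPeriodicCfg_gaugeAct hut_P hUPm
  have hcritV := tanCritical_gaugeAct hL1 k hU hx hs hUx (P := L ^ (k + 1) * (N * m)) hut_u hut_P hcritm
  have htopV : cavgIter L (k + 1) (gaugeAct ut U) = flat := by
    rw [cavgIter_gaugeAct hL1 k hU hx hs hUx hut_u, htopU]
    have hcorner : (fun y : Site (d + 1) => ut (((L : ℤ) ^ (k + 1)) • y)) = fun y => (w y)⁻¹ := by
      funext y
      exact blowInv_corner hL1 k w y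
    rw [hcorner]
    exact gaugeAct_inv_gaugeAct w flat
  -- (3) the OWNER's END at `N·m` blocks, then back along the gauge
  have hV := hD8 (N * m) k hVu hx hs hVx hδ hVδ hδx hcritV htopV hVP hθ hθl hε hδθ
  have hback := smallField_gaugeAct (u := fun z => (ut z)⁻¹) (fun z => (unitaryUnits (Matrix n n ℂ)).inv_mem (hut_u z)) hV
  rwa [gaugeAct_inv_gaugeAct] at hback

/-! ## §3 The intrinsic form: zero curvature and trivial `m`-fold axis holonomies of the datum -/

/-- **(APE) ON THE FIBRE OVER A FLAT DATUM WITH FINITE-ORDER HOLONOMY — INTRINSIC FORM.**  `∃ K′ θ > 0` (D8's clause): for all `N, m ≥ 1`, `k`, every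
unitary `(L^{k+1}N)`-periodic `U` of the multi-level class whose `(k+1)`-fold average `D = cavgIter L (k+1) U` is FLAT (`D(∂P) = 1` for every coarse
plaquette) with TRIVIAL `m`-FOLD AXIS HOLONOMIES `D([0, (N·m)e_i]) = 1` (the holonomy constants have order dividing `m`), `SmallField U (δ∕M²)` with
`0 ≤ δ ≤ θ`, `δ∕M² ≤ x`, tangent-critical at period `L^{k+1}N`: `SmallField U (K′δ²∕M²)`. [folklore] -/
theorem smallField_of_tanCritical_flatDatum {n : Type} [Fintype n] [DecidableEq n] [Nonempty n] (hd : 1 ≤ d) {L : ℕ} (hL : 2 ≤ L) :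
    ∃ K' θ : ℝ, 0 < K' ∧ 0 < θ ∧ ∀ (N : ℕ) [NeZero N] (m : ℕ) [NeZero m] (k : ℕ)
      {U : Site (d + 1) → Fin (d + 1) → (Matrix n n ℂ)ˣ} (_hU : IsUnitaryCfg U) {x δ : ℝ} (_hx : 0 ≤ x) (_hs : LevelSmall (d + 1) L k x)
      (_hUx : SmallField U x) (_hδ : 0 ≤ δ) (_hUδ : SmallField U (δ / ((L : ℝ) ^ (k + 1)) ^ 2)) (_hδx : δ / ((L : ℝ) ^ (k + 1)) ^ 2 ≤ x)
      (_hcritU : ∀ φ : Site (d + 1) → Fin (d + 1) → Matrix n n ℂ, IsSkewDir φ → IsPeriodicDir φ ((L ^ (k + 1) * N : ℕ) : ℤ) →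
        dirIter L (k + 1) U φ = 0 → dAction U φ (perWin (d + 1) (L ^ (k + 1) * N)) = 0)
      (_hflatD : ∀ (y : Site (d + 1)) (κ μ : Fin (d + 1)), κ ≠ μ → hol (cavgIter L (k + 1) U) y (plaqWord κ μ) = 1)
      (_hholD : ∀ i : Fin (d + 1), hol (cavgIter L (k + 1) U) 0 (seg i (((N * m : ℕ) : ℤ))) = 1)
      (_hUP : IsPeriodicCfg U ((L ^ (k + 1) * N : ℕ) : ℤ))
      (_hθ : cruxC (d + 1) L * (((L : ℝ) ^ (k + 1)) ^ 2 * x) < 1) (_hθl : thetaLoc (d + 1) L * (((L : ℝ) ^ (k + 1)) ^ 2 * x) ≤ 1 / 2)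
      (_hε : ((L : ℝ) ^ (k + 1)) ^ 2 * x ≤ 1) (_hδθ : δ ≤ θ),
      SmallField U (K' * δ ^ 2 / ((L : ℝ) ^ (k + 1)) ^ 2) := by
  obtain ⟨K', θ, hK', hθ0, hD9⟩ := smallField_of_tanCritical_flatToron (n := n) hd hL
  refine ⟨K', θ, hK', hθ0, ?_⟩
  intro N _ m _ k U hU x δ hx hs hUx hδ hUδ hδx hcritU hflatD hholD hUP hθ hθl hε hδθ
  have hL1 : 1 ≤ L := by omega
  -- the datum is a pure gauge `1^{g}`
  have hDu : IsUnitaryCfg (cavgIter L (k + 1) U) := (cavgIter_unitary_small hL1 k hU hx hs hUx).1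
  obtain ⟨g, hgu, hDg⟩ := exists_unitary_gauge_eq_gaugeAct_flatCfg hDu hflatD
  -- the datum is `N`-periodic, hence `(N·m)`-periodic
  have hDP : IsPeriodicCfg (cavgIter L (k + 1) U) (N : ℤ) := by
    refine isPeriodicCfg_cavgIter L N (k + 1) ?_
    rw [tower_eq_pow_mul]
    exact hUP
  have hDPm : IsPeriodicCfg (gaugeAct g (flatCfg : Site (d + 1) → Fin (d + 1) → (Matrix n n ℂ)ˣ)) (((N * m : ℕ) : ℤ)) := by
    rw [← hDg]
    have h := isPeriodicCfg_mul hDP (m : ℤ)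
    push_cast at h ⊢
    exact h
  -- its holonomy constants over `N·m` steps are trivial, so `g` is `(N·m)`-periodic
  have hgP : ∀ (y : Site (d + 1)) (i : Fin (d + 1)), g (y + ((N * m : ℕ) : ℤ) • e i) = g y := by
    intro y i
    have hconst := apply_add_period_eq_of_isPeriodicCfg hDPm y i
    have hhol := hholD i
    rw [hDg, hol_gaugeAct, disp_seg, zero_add] at hhol
    have h1 : hol (flatCfg : Site (d + 1) → Fin (d + 1) → (Matrix n n ℂ)ˣ) 0 (seg i (((N * m : ℕ) : ℤ))) = 1 := hol_flat _ _
    rw [h1, mul_one, mul_inv_eq_one] at hhol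
    rw [hconst, ← hhol, inv_mul_cancel, mul_one]
  -- the fibre in D9's form
  have htopU : cavgIter L (k + 1) U = gaugeAct g flat := hDg
  exact hD9 N m k g hgu hgP hU hx hs hUx hδ hUδ hδx hcritU htopU hUP hθ hθl hε hδθ

/-! ## §4 THE END ITERATED: tangent-critical + small field on a flat fibre (finite-order holonomy) ⟹ FLAT -/

/-- **TANGENT-CRITICAL SMALL-FIELD CONFIGURATIONS ON THE FIBRE OVER A FLAT DATUM WITH FINITE-ORDER HOLONOMY ARE FLAT.**  `∃ θ₀ > 0` (on `d`, `card n`,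
`L`): for all `N, m ≥ 1`, `k`, every unitary `(N·m)`-periodic `w`, every unitary `(L^{k+1}N)`-periodic `U` of the multi-level class (`SmallField U x`,
`LevelSmall`, `cruxC·M²x < 1`, `thetaLoc·M²x ≤ 1∕2`, `M²x ≤ 1`) with `SmallField U (δ∕M²)`, `0 ≤ δ ≤ θ₀`, `δ∕M² ≤ x`, `cavgIter L (k+1) U = 1^{w}` and
tangent-critical at period `L^{k+1}N`: `SmallField U 0`. [folklore] -/
theorem smallField_zero_of_tanCritical_flatToron {n : Type} [Fintype n] [DecidableEq n] [Nonempty n] (hd : 1 ≤ d) {L : ℕ} (hL : 2 ≤ L) :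
    ∃ θ₀ : ℝ, 0 < θ₀ ∧ ∀ (N : ℕ) [NeZero N] (m : ℕ) [NeZero m] (k : ℕ)
      (w : Site (d + 1) → (Matrix n n ℂ)ˣ) (_hw : IsUnitarySite w)
      (_hwP : ∀ (y : Site (d + 1)) (i : Fin (d + 1)), w (y + ((N * m : ℕ) : ℤ) • e i) = w y)
      {U : Site (d + 1) → Fin (d + 1) → (Matrix n n ℂ)ˣ} (_hU : IsUnitaryCfg U) {x δ : ℝ} (_hx : 0 ≤ x) (_hs : LevelSmall (d + 1) L k x)
      (_hUx : SmallField U x) (_hδ : 0 ≤ δ) (_hUδ : SmallField U (δ / ((L : ℝ) ^ (k + 1)) ^ 2)) (_hδx : δ / ((L : ℝ) ^ (k + 1)) ^ 2 ≤ x)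
      (_hcritU : ∀ φ : Site (d + 1) → Fin (d + 1) → Matrix n n ℂ, IsSkewDir φ → IsPeriodicDir φ ((L ^ (k + 1) * N : ℕ) : ℤ) →
        dirIter L (k + 1) U φ = 0 → dAction U φ (perWin (d + 1) (L ^ (k + 1) * N)) = 0)
      (_htopU : cavgIter L (k + 1) U = gaugeAct w flat) (_hUP : IsPeriodicCfg U ((L ^ (k + 1) * N : ℕ) : ℤ))
      (_hθ : cruxC (d + 1) L * (((L : ℝ) ^ (k + 1)) ^ 2 * x) < 1) (_hθl : thetaLoc (d + 1) L * (((L : ℝ) ^ (k + 1)) ^ 2 * x) ≤ 1 / 2)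
      (_hε : ((L : ℝ) ^ (k + 1)) ^ 2 * x ≤ 1) (_hδθ : δ ≤ θ₀),
      SmallField U 0 := by
  obtain ⟨K', θ, hK', hθ0, hD9⟩ := smallField_of_tanCritical_flatToron (n := n) hd hL
  refine ⟨min θ (1 / (2 * K')), lt_min hθ0 (by positivity), ?_⟩
  intro N _ m _ k w hw hwP U hU x δ hx hs hUx hδ hUδ hδx hcritU htopU hUP hθ hθl hε hδθ
  have hM₂ : 0 < ((L : ℝ) ^ (k + 1)) ^ 2 := by positivity
  have hδθ' : δ ≤ θ := hδθ.trans (min_le_left _ _)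
  have hKδ : K' * δ ≤ 1 / 2 := by
    have h1 : δ ≤ 1 / (2 * K') := hδθ.trans (min_le_right _ _)
    calc K' * δ ≤ K' * (1 / (2 * K')) := mul_le_mul_of_nonneg_left h1 hK'.le
      _ = 1 / 2 := by field_simp
  refine smallField_zero_of_bootstrap (K := K') (θ := θ) hK'.le hM₂ ?_ hδ hδθ' hKδ hUδ
  intro δ' hδ' hδ'θ hUδ'
  by_cases hδ'x : δ' / ((L : ℝ) ^ (k + 1)) ^ 2 ≤ x
  · exact hD9 N m k w hw hwP hU hx hs hUx hδ' hUδ' hδ'x hcritU htopU hUP hθ hθl hε hδ'θ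
  · -- a radius above `x` is dominated by the class radius `x` itself: use the bootstrap at the radius `x·M²`... not needed:
    -- `SmallField U x` and `x < δ'∕M²` give `SmallField U (δ''∕M²)` for `δ'' := x·M² < δ'`, and monotonicity in the conclusion.
    have hδ'x' : x < δ' / ((L : ℝ) ^ (k + 1)) ^ 2 := not_le.mp hδ'x
    have hxM : x = (x * ((L : ℝ) ^ (k + 1)) ^ 2) / ((L : ℝ) ^ (k + 1)) ^ 2 := by field_simp
    have hδ'' : 0 ≤ x * ((L : ℝ) ^ (k + 1)) ^ 2 := by positivity
    have hlt : x * ((L : ℝ) ^ (k + 1)) ^ 2 ≤ δ' := ((lt_div_iff₀ hM₂).mp hδ'x').le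
    have hUδ'' : SmallField U ((x * ((L : ℝ) ^ (k + 1)) ^ 2) / ((L : ℝ) ^ (k + 1)) ^ 2) := by rw [← hxM]; exact hUx
    have h := hD9 N m k w hw hwP hU hx hs hUx hδ'' hUδ'' (by rw [← hxM]) hcritU htopU hUP hθ hθl hε (hlt.trans hδ'θ)
    intro y κ κ' hκ
    refine (h y κ κ' hκ).trans (div_le_div_of_nonneg_right ?_ hM₂.le)
    exact mul_le_mul_of_nonneg_left (pow_le_pow_left₀ hδ'' hlt 2) hK'.le

/-! ## §5 Zero curvature is pure gauge: uniqueness of the critical point modulo gauge -/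

/-- **RIGIDITY ∕ UNIQUENESS MODULO GAUGE ON FLAT FIBRES.**  `∃ θ₀ > 0`: under the hypotheses of §2 (tangent-critical, small field `δ ≤ θ₀`, on the fibre
over the flat datum `1^{w}` with `w` unitary `(N·m)`-periodic) the configuration is a PURE GAUGE: `∃ g` unitary with `U = 1^{g}`. [folklore] -/
theorem exists_pureGauge_of_tanCritical_flatToron {n : Type} [Fintype n] [DecidableEq n] [Nonempty n] (hd : 1 ≤ d) {L : ℕ} (hL : 2 ≤ L) :
    ∃ θ₀ : ℝ, 0 < θ₀ ∧ ∀ (N : ℕ) [NeZero N] (m : ℕ) [NeZero m] (k : ℕ)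
      (w : Site (d + 1) → (Matrix n n ℂ)ˣ) (_hw : IsUnitarySite w)
      (_hwP : ∀ (y : Site (d + 1)) (i : Fin (d + 1)), w (y + ((N * m : ℕ) : ℤ) • e i) = w y)
      {U : Site (d + 1) → Fin (d + 1) → (Matrix n n ℂ)ˣ} (_hU : IsUnitaryCfg U) {x δ : ℝ} (_hx : 0 ≤ x) (_hs : LevelSmall (d + 1) L k x)
      (_hUx : SmallField U x) (_hδ : 0 ≤ δ) (_hUδ : SmallField U (δ / ((L : ℝ) ^ (k + 1)) ^ 2)) (_hδx : δ / ((L : ℝ) ^ (k + 1)) ^ 2 ≤ x)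
      (_hcritU : ∀ φ : Site (d + 1) → Fin (d + 1) → Matrix n n ℂ, IsSkewDir φ → IsPeriodicDir φ ((L ^ (k + 1) * N : ℕ) : ℤ) →
        dirIter L (k + 1) U φ = 0 → dAction U φ (perWin (d + 1) (L ^ (k + 1) * N)) = 0)
      (_htopU : cavgIter L (k + 1) U = gaugeAct w flat) (_hUP : IsPeriodicCfg U ((L ^ (k + 1) * N : ℕ) : ℤ))
      (_hθ : cruxC (d + 1) L * (((L : ℝ) ^ (k + 1)) ^ 2 * x) < 1) (_hθl : thetaLoc (d + 1) L * (((L : ℝ) ^ (k + 1)) ^ 2 * x) ≤ 1 / 2)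
      (_hε : ((L : ℝ) ^ (k + 1)) ^ 2 * x ≤ 1) (_hδθ : δ ≤ θ₀),
      ∃ g : Site (d + 1) → (Matrix n n ℂ)ˣ, IsUnitarySite g ∧ U = gaugeAct g flat := by
  obtain ⟨θ₀, hθ₀, hflat⟩ := smallField_zero_of_tanCritical_flatToron (n := n) hd hL
  refine ⟨θ₀, hθ₀, ?_⟩
  intro N _ m _ k w hw hwP U hU x δ hx hs hUx hδ hUδ hδx hcritU htopU hUP hθ hθl hε hδθ
  have h0 := hflat N m k w hw hwP hU hx hs hUx hδ hUδ hδx hcritU htopU hUP hθ hθl hε hδθ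
  obtain ⟨g, hgu, hUg⟩ := exists_unitary_gauge_eq_gaugeAct_flatCfg hU (hol_plaqWord_eq_one_of_smallField_zero h0)
  exact ⟨g, hgu, hUg⟩

end

end Summit.QuantumFields.BalabanUV.T4Continuum.NE7ApeFlatToronEnd
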